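import Summits.AtomisticToContinuum.BoseEinsteinCondensation.Theorems.BECCutLineWeakDisorderAcrossCutCrossCovarianceFinite
import Summits.AtomisticToContinuum.BoseEinsteinCondensation.Theorems.BECCutLineWeakDisorderTwoReplicaTransienceBoundTracerMeasurable
import Literature.MathematicalPhysics.QuantumManyBody.GroundStateFeynmanKacSemigroup
import HarnessLib

/-!
# Crux `TwoReplicaTransienceBound` (stmt-AtomisticToContinuum-9687), line `across-cut-thinning` v2:
# the TWO-SIDED bath space and the realisation of `crossTilt` as `tiltLaplace` (`stub_tiltRealisation`)

Support file (`--supports stmt-AtomisticToContinuum-9687`, lead c6; infrastructure of the registered stub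
`stub_blockOfCovariance : TiltFTC → BlockOfCovarianceReduction`). For a BOUNDED measurable pair
potential `v ≤ C` and `T ≥ 0`, the line's two-sided tilted cross moments
`crossTilt s t i j v L T x ω₀ x' ω₀' = ∫_Y E_Y[w A^i e^{-sA}] E_Y[w A'^j e^{-tA'}] dY` ARE the abstract
tilted Laplace moments `tiltLaplace μ A A' s t i j = ∫ A^i A'^j e^{-(sA+tA')} dμ` (the objects the
device `TiltFTC` speaks about) of the realised, bounded doses `A = taggedBathAction v T x Y ω₀ ωb`,
`A' = taggedBathAction v T x' Y ω₀' ωb'` (`≤ n C T`) on the finite measure space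
`(Y, ωb, ωb') ∼ w(Y,ωb) w(Y,ωb') dY dW dW` (`twoSidedMeasure`: `Measure.withDensity` of the product
measure; total mass `∫ Z_n² = bathTwo < ∞`): Tonelli (`lintegral_prod`, `lintegral_prod_mul`), the
joint measurability of the tagged–bath action (`TracerMeasurability.measurable_taggedBathIntegrand`)
and the `ℝ ↔ [0,∞]` bookkeeping `ofReal (a^i e^{-sa}) = A^i · expNeg (s A)`. Also the corners
`crossTilt 1 1 0 0 = crossFull`, `crossTilt 1 0 0 0 = crossHalf x ω₀`, `crossTilt 0 1 0 0 = crossHalf x' ω₀'`.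
-/

noncomputable section

open MeasureTheory Filter Set Finset
open scoped ENNReal NNReal Topology BigOperators

namespace Summit.AtomisticToContinuum.BoseEinsteinCondensation.Cruxes.TwoReplicaTransienceBound.AcrossCutThinning

open Literature.MathematicalPhysics.QuantumManyBody.BoseGas
open Summit.AtomisticToContinuum.BoseEinsteinCondensation.Cruxes.TwoReplicaTransienceBound.TracerDecoupling
open Summit.AtomisticToContinuum.BoseEinsteinCondensation.Cruxes.TwoReplicaTransienceBound.TracerDecoupling.TracerMeasurability

variable {n : ℕ}

namespace FourPoint

/-! ### The dose: bound and measurability -/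

/-- **Dose bound**: for `v ≤ C` and `T ≥ 0`, `taggedBathAction v T x Y ω₀ ωb ≤ n · C · T`. -/
theorem taggedBathAction_le {v : ℝ → ℝ≥0∞} {C : ℝ≥0} (hC : ∀ r, v r ≤ C) (T : ℝ) (x : Space)
    (Y : Config n) (ω₀ : Fin 3 → (ℝ≥0 → ℝ)) (ωb : PathSpace n) :
    taggedBathAction v T x Y ω₀ ωb ≤ (n : ℝ≥0∞) * C * ENNReal.ofReal T := by
  unfold taggedBathAction
  calc _ ≤ ∫⁻ _ in Set.Ioc (0 : ℝ) T, (n : ℝ≥0∞) * C := by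
        refine lintegral_mono fun s => ?_
        calc _ ≤ ∑ _j : Fin n, (C : ℝ≥0∞) := Finset.sum_le_sum fun j _ => hC _
          _ = (n : ℝ≥0∞) * C := by
              rw [Finset.sum_const, Finset.card_univ, Fintype.card_fin, nsmul_eq_mul]
    _ = (n : ℝ≥0∞) * C * volume (Set.Ioc (0 : ℝ) T) := setLIntegral_const _ _
    _ = (n : ℝ≥0∞) * C * ENNReal.ofReal T := by rw [Real.volume_Ioc, sub_zero]

/-- The dose is finite for bounded `v`. -/
theorem taggedBathAction_ne_top {v : ℝ → ℝ≥0∞} {C : ℝ≥0} (hC : ∀ r, v r ≤ C) (T : ℝ) (x : Space)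
    (Y : Config n) (ω₀ : Fin 3 → (ℝ≥0 → ℝ)) (ωb : PathSpace n) :
    taggedBathAction v T x Y ω₀ ωb ≠ ⊤ :=
  ne_top_of_le_ne_top (ENNReal.mul_ne_top (ENNReal.mul_ne_top (ENNReal.natCast_ne_top n)
    ENNReal.coe_ne_top) ENNReal.ofReal_ne_top) (taggedBathAction_le hC T x Y ω₀ ωb)

/-- Joint measurability of the dose in (slice, bath sample) for a frozen tagged path. -/
theorem measurable_taggedBathAction_slice {v : ℝ → ℝ≥0∞} (hv : Measurable v) (T : ℝ) (x : Space)
    (ω₀ : Fin 3 → (ℝ≥0 → ℝ)) :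
    Measurable fun q : Config n × PathSpace n => taggedBathAction v T x q.1 ω₀ q.2 := by
  have hπ : Measurable fun r : (Config n × PathSpace n) × ℝ => (x, r.1.1) :=
    measurable_const.prodMk (measurable_fst.comp measurable_fst)
  have hX' := measurable_vecCons.comp hπ
  have hX : Measurable fun r : (Config n × PathSpace n) × ℝ =>
      (Matrix.vecCons x r.1.1 : Config (n + 1)) := hX'
  have hω : Measurable fun r : (Config n × PathSpace n) × ℝ =>
      (Fin.cons ω₀ r.1.2 : PathSpace (n + 1)) :=
    measurable_finCons measurable_const (measurable_snd.comp measurable_fst)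
  have h := measurable_taggedBathIntegrand hv hX hω measurable_snd
  unfold taggedBathAction
  exact h.lintegral_prod_right'

/-! ### Real ↔ `[0,∞]` conversion of the tilt factors -/

/-- For a finite dose `τ` and `s ≥ 0`:
`ofReal (τ.toReal ^ i · e^{-s τ.toReal}) = τ^i · expNeg (s · τ)`. -/
theorem ofReal_pow_mul_exp {τ : ℝ≥0∞} (hτ : τ ≠ ⊤) {s : ℝ} (hs : 0 ≤ s) (i : ℕ) :
    ENNReal.ofReal (τ.toReal ^ i * Real.exp (-(s * τ.toReal))) =
      τ ^ i * expNeg ((s.toNNReal : ℝ≥0∞) * τ) := by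
  have hst : (s.toNNReal : ℝ≥0∞) * τ ≠ ⊤ := ENNReal.mul_ne_top ENNReal.coe_ne_top hτ
  rw [ENNReal.ofReal_mul (pow_nonneg ENNReal.toReal_nonneg _), ← ENNReal.toReal_pow,
    ENNReal.ofReal_toReal (ENNReal.pow_ne_top hτ)]
  congr 1
  unfold expNeg
  rw [if_neg hst, ENNReal.toReal_mul, ENNReal.coe_toReal, Real.coe_toNNReal _ hs]

end FourPoint

open FourPoint

/-! ### The corners of the tilt family -/

/-- `sideFactor 1 0 = sideWeight` (tube at full strength, no dose insertion). -/
theorem sideFactor_one_zero (v : ℝ → ℝ≥0∞) (L T : ℝ) (x : Space) (Y : Config n)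
    (ω₀ : Fin 3 → (ℝ≥0 → ℝ)) : sideFactor 1 0 v L T x Y ω₀ = sideWeight v L T x Y ω₀ := by
  unfold sideFactor sideWeight
  refine lintegral_congr fun ωb => ?_
  simp only [pow_zero, ENNReal.coe_one, one_mul]

/-- `Λ_{1,1}[1] = crossFull`. -/
theorem crossTilt_one_one (v : ℝ → ℝ≥0∞) (L T : ℝ) (x : Space) (ω₀ : Fin 3 → (ℝ≥0 → ℝ))
    (x' : Space) (ω₀' : Fin 3 → (ℝ≥0 → ℝ)) :
    crossTilt (n := n) 1 1 0 0 v L T x ω₀ x' ω₀' = crossFull (n := n) v L T x ω₀ x' ω₀' := by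
  unfold crossTilt crossFull
  refine lintegral_congr fun Y => ?_
  rw [sideFactor_one_zero, sideFactor_one_zero]

/-- `Λ_{1,0}[1] = crossHalf x ω₀`. -/
theorem crossTilt_one_zero (v : ℝ → ℝ≥0∞) (L T : ℝ) (x : Space) (ω₀ : Fin 3 → (ℝ≥0 → ℝ))
    (x' : Space) (ω₀' : Fin 3 → (ℝ≥0 → ℝ)) :
    crossTilt (n := n) 1 0 0 0 v L T x ω₀ x' ω₀' = crossHalf (n := n) v L T x ω₀ := by
  unfold crossTilt crossHalf
  refine lintegral_congr fun Y => ?_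
  rw [sideFactor_one_zero, sideFactor_zero_zero]

/-- `Λ_{0,1}[1] = crossHalf x' ω₀'`. -/
theorem crossTilt_zero_one (v : ℝ → ℝ≥0∞) (L T : ℝ) (x : Space) (ω₀ : Fin 3 → (ℝ≥0 → ℝ))
    (x' : Space) (ω₀' : Fin 3 → (ℝ≥0 → ℝ)) :
    crossTilt (n := n) 0 1 0 0 v L T x ω₀ x' ω₀' = crossHalf (n := n) v L T x' ω₀' := by
  unfold crossTilt crossHalf
  refine lintegral_congr fun Y => ?_
  rw [sideFactor_one_zero, sideFactor_zero_zero, mul_comm]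

/-! ### The two-sided bath space and the realisation of `crossTilt` as `tiltLaplace` -/

section Realisation

variable {v : ℝ → ℝ≥0∞} {C : ℝ≥0} {L T : ℝ}

/-- The density `w(Y,ωb) · w(Y,ωb')` of the two-sided bath space (two independent bath histories from
ONE slice). -/
def twoSidedDensity (v : ℝ → ℝ≥0∞) (L T : ℝ) (n : ℕ) :
    Config n × (PathSpace n × PathSpace n) → ℝ≥0∞ :=
  fun q => fkWeight v L T q.1 q.2.1 * fkWeight v L T q.1 q.2.2

/-- The two-sided bath measure `w(Y,ωb) w(Y,ωb') dY dW(ωb) dW(ωb')`. -/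
def twoSidedMeasure (v : ℝ → ℝ≥0∞) (L T : ℝ) (n : ℕ) :
    Measure (Config n × (PathSpace n × PathSpace n)) :=
  ((volume : Measure (Config n)).prod ((wienerPaths n).prod (wienerPaths n))).withDensity
    (twoSidedDensity v L T n)

/-- The two-sided density is jointly measurable. -/
theorem measurable_twoSidedDensity (hv : Measurable v) (L T : ℝ) (n : ℕ) :
    Measurable (twoSidedDensity v L T n) := by
  have hw := measurable_fkWeight_uncurry (N := n) hv L T
  have hπ : Measurable fun q : Config n × (PathSpace n × PathSpace n) => (q.1, q.2.1) :=
    measurable_fst.prodMk (measurable_fst.comp measurable_snd)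
  have hπ' : Measurable fun q : Config n × (PathSpace n × PathSpace n) => (q.1, q.2.2) :=
    measurable_fst.prodMk (measurable_snd.comp measurable_snd)
  have h := (hw.comp hπ).mul (hw.comp hπ')
  exact h

/-- `∫ w dW = Z_n(Y)`. -/
theorem lintegral_fkWeight_eq_fkPartition (v : ℝ → ℝ≥0∞) (L T : ℝ) (Y : Config n) :
    ∫⁻ ωb, fkWeight v L T Y ωb ∂wienerPaths n = fkPartition v L T Y := by
  simp [fkPartition, fkSemigroup]

/-- **Tonelli on the two-sided bath space**: for measurable `G, H : Config n × PathSpace n → [0,∞]`,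
`∫ w w' · G(Y,ωb) H(Y,ωb') = ∫_Y (∫ w G(Y,·) dW)(∫ w H(Y,·) dW) dY`. -/
theorem lintegral_twoSided (hv : Measurable v) (L T : ℝ)
    {G H : Config n × PathSpace n → ℝ≥0∞} (hG : Measurable G) (hH : Measurable H) :
    ∫⁻ q, twoSidedDensity v L T n q * (G (q.1, q.2.1) * H (q.1, q.2.2))
        ∂(volume : Measure (Config n)).prod ((wienerPaths n).prod (wienerPaths n)) =
      ∫⁻ Y : Config n, (∫⁻ ωb, fkWeight v L T Y ωb * G (Y, ωb) ∂wienerPaths n) *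
        (∫⁻ ωb, fkWeight v L T Y ωb * H (Y, ωb) ∂wienerPaths n) := by
  have hπ : Measurable fun q : Config n × (PathSpace n × PathSpace n) => (q.1, q.2.1) :=
    measurable_fst.prodMk (measurable_fst.comp measurable_snd)
  have hπ' : Measurable fun q : Config n × (PathSpace n × PathSpace n) => (q.1, q.2.2) :=
    measurable_fst.prodMk (measurable_snd.comp measurable_snd)
  have hFm' := (measurable_twoSidedDensity hv L T n).mul ((hG.comp hπ).mul (hH.comp hπ'))
  have hFm : Measurable fun q : Config n × (PathSpace n × PathSpace n) =>
      twoSidedDensity v L T n q * (G (q.1, q.2.1) * H (q.1, q.2.2)) := hFm'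
  rw [lintegral_prod _ hFm.aemeasurable]
  refine lintegral_congr fun Y => ?_
  have hι : Measurable fun ωb : PathSpace n => (Y, ωb) := measurable_const.prodMk measurable_id
  have hGY'' := (measurable_fkWeight hv L T Y).mul (hG.comp hι)
  have hHY'' := (measurable_fkWeight hv L T Y).mul (hH.comp hι)
  have hGY : Measurable fun ωb => fkWeight v L T Y ωb * G (Y, ωb) := hGY''
  have hHY : Measurable fun ωb => fkWeight v L T Y ωb * H (Y, ωb) := hHY''
  rw [← lintegral_prod_mul hGY.aemeasurable hHY.aemeasurable]
  refine lintegral_congr fun p => ?_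
  show fkWeight v L T Y p.1 * fkWeight v L T Y p.2 * (G (Y, p.1) * H (Y, p.2)) = _
  ring

/-- Total mass of the two-sided bath space: `∫ w w' = ∫ Z_n² = bathTwo`. -/
theorem lintegral_twoSidedDensity (hv : Measurable v) (L T : ℝ) (n : ℕ) :
    ∫⁻ q, twoSidedDensity v L T n q
        ∂(volume : Measure (Config n)).prod ((wienerPaths n).prod (wienerPaths n)) =
      bathTwo v L T n := by
  have h := lintegral_twoSided (n := n) hv L T (G := fun _ => 1) (H := fun _ => 1)
    measurable_const measurable_const
  simp only [mul_one] at h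
  rw [h]
  unfold bathTwo
  refine lintegral_congr fun Y => ?_
  rw [lintegral_fkWeight_eq_fkPartition, sq]

/-- The realised doses. -/
def doseA (v : ℝ → ℝ≥0∞) (T : ℝ) (x : Space) (ω₀ : Fin 3 → (ℝ≥0 → ℝ)) :
    Config n × (PathSpace n × PathSpace n) → ℝ :=
  fun q => (taggedBathAction v T x q.1 ω₀ q.2.1).toReal

/-- The realised future dose. -/
def doseA' (v : ℝ → ℝ≥0∞) (T : ℝ) (x' : Space) (ω₀' : Fin 3 → (ℝ≥0 → ℝ)) :
    Config n × (PathSpace n × PathSpace n) → ℝ :=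
  fun q => (taggedBathAction v T x' q.1 ω₀' q.2.2).toReal

/-- The realised past dose is measurable. -/
theorem measurable_doseA (hv : Measurable v) (T : ℝ) (x : Space) (ω₀ : Fin 3 → (ℝ≥0 → ℝ)) :
    Measurable (doseA (n := n) v T x ω₀) := by
  have hπ : Measurable fun q : Config n × (PathSpace n × PathSpace n) => (q.1, q.2.1) :=
    measurable_fst.prodMk (measurable_fst.comp measurable_snd)
  have h := ((measurable_taggedBathAction_slice hv T x ω₀).comp hπ).ennreal_toReal
  exact h

/-- The realised future dose is measurable. -/
theorem measurable_doseA' (hv : Measurable v) (T : ℝ) (x' : Space) (ω₀' : Fin 3 → (ℝ≥0 → ℝ)) :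
    Measurable (doseA' (n := n) v T x' ω₀') := by
  have hπ' : Measurable fun q : Config n × (PathSpace n × PathSpace n) => (q.1, q.2.2) :=
    measurable_fst.prodMk (measurable_snd.comp measurable_snd)
  have h := ((measurable_taggedBathAction_slice hv T x' ω₀').comp hπ').ennreal_toReal
  exact h

/-- **Realisation**: the abstract tilted Laplace moments of the realised doses on the two-sided bath
space ARE the line's two-sided tilted cross moments (finite), for `s, t ≥ 0`. -/
theorem tiltLaplace_eq_crossTilt (hv : Measurable v) (hC : ∀ r, v r ≤ C) (L : ℝ) (hT : 0 ≤ T)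
    (x : Space) (ω₀ : Fin 3 → (ℝ≥0 → ℝ)) (x' : Space) (ω₀' : Fin 3 → (ℝ≥0 → ℝ))
    {s t : ℝ} (hs : 0 ≤ s) (ht : 0 ≤ t) (i j : ℕ) :
    crossTilt (n := n) s.toNNReal t.toNNReal i j v L T x ω₀ x' ω₀' ≠ ⊤ ∧
    tiltLaplace (twoSidedMeasure v L T n) (doseA v T x ω₀) (doseA' v T x' ω₀') s t i j =
      (crossTilt (n := n) s.toNNReal t.toNNReal i j v L T x ω₀ x' ω₀').toReal := by
  set μ := twoSidedMeasure v L T n with hμdef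
  set A := doseA (n := n) v T x ω₀ with hAdef
  set A' := doseA' (n := n) v T x' ω₀' with hA'def
  have hAm : Measurable A := measurable_doseA hv T x ω₀
  have hA'm : Measurable A' := measurable_doseA' hv T x' ω₀'
  -- the integrand and its `[0,∞]` version
  set f : Config n × (PathSpace n × PathSpace n) → ℝ :=
    fun q => A q ^ i * A' q ^ j * Real.exp (-(s * A q + t * A' q)) with hfdef
  have hf0 : ∀ q, 0 ≤ f q := fun q =>
    mul_nonneg (mul_nonneg (pow_nonneg ENNReal.toReal_nonneg _)
      (pow_nonneg ENNReal.toReal_nonneg _)) (Real.exp_pos _).le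
  have hfm : Measurable f :=
    ((hAm.pow_const i).mul (hA'm.pow_const j)).mul
      (Real.measurable_exp.comp (((measurable_const.mul hAm).add (measurable_const.mul hA'm)).neg))
  -- the factorised `[0,∞]` integrand
  set G : Config n × PathSpace n → ℝ≥0∞ := fun p =>
    taggedBathAction v T x p.1 ω₀ p.2 ^ i *
      expNeg ((s.toNNReal : ℝ≥0∞) * taggedBathAction v T x p.1 ω₀ p.2) with hGdef
  set H : Config n × PathSpace n → ℝ≥0∞ := fun p =>
    taggedBathAction v T x' p.1 ω₀' p.2 ^ j *
      expNeg ((t.toNNReal : ℝ≥0∞) * taggedBathAction v T x' p.1 ω₀' p.2) with hHdef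
  have hτm : Measurable fun p : Config n × PathSpace n => taggedBathAction v T x p.1 ω₀ p.2 :=
    measurable_taggedBathAction_slice hv T x ω₀
  have hτm' : Measurable fun p : Config n × PathSpace n => taggedBathAction v T x' p.1 ω₀' p.2 :=
    measurable_taggedBathAction_slice hv T x' ω₀'
  have hGm : Measurable G := (hτm.pow_const i).mul (measurable_expNeg.comp (hτm.const_mul _))
  have hHm : Measurable H := (hτm'.pow_const j).mul (measurable_expNeg.comp (hτm'.const_mul _))
  have hfGH : ∀ q : Config n × (PathSpace n × PathSpace n),
      ENNReal.ofReal (f q) = G (q.1, q.2.1) * H (q.1, q.2.2) := by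
    intro q
    have h1 := ofReal_pow_mul_exp (taggedBathAction_ne_top hC T x q.1 ω₀ q.2.1) hs i
    have h2 := ofReal_pow_mul_exp (taggedBathAction_ne_top hC T x' q.1 ω₀' q.2.2) ht j
    simp only [hfdef, hGdef, hHdef, hAdef, hA'def, doseA, doseA']
    rw [← h1, ← h2, ← ENNReal.ofReal_mul (mul_nonneg (pow_nonneg ENNReal.toReal_nonneg _)
      (Real.exp_pos _).le)]
    congr 1
    rw [neg_add, Real.exp_add]
    ring
  -- the `[0,∞]` integral is `crossTilt`
  have hlin : ∫⁻ q, ENNReal.ofReal (f q) ∂μ =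
      crossTilt (n := n) s.toNNReal t.toNNReal i j v L T x ω₀ x' ω₀' := by
    have hgm : Measurable fun q => ENNReal.ofReal (f q) := ENNReal.measurable_ofReal.comp hfm
    rw [hμdef, twoSidedMeasure, lintegral_withDensity_eq_lintegral_mul _
      (measurable_twoSidedDensity hv L T n) hgm]
    have : (twoSidedDensity v L T n * fun q => ENNReal.ofReal (f q)) =
        fun q => twoSidedDensity v L T n q * (G (q.1, q.2.1) * H (q.1, q.2.2)) := by
      funext q; simp only [Pi.mul_apply, hfGH q]
    rw [this, lintegral_twoSided hv L T hGm hHm]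
    rfl
  -- finiteness: `f ≤ D^i D^j`
  set D : ℝ := (n : ℝ) * C * T with hDdef
  have hD0 : 0 ≤ D := by positivity
  have hAle : ∀ q, A q ≤ D := fun q => by
    show (taggedBathAction v T x q.1 ω₀ q.2.1).toReal ≤ D
    have h := taggedBathAction_le (n := n) hC T x q.1 ω₀ q.2.1
    have h' := ENNReal.toReal_mono (ENNReal.mul_ne_top (ENNReal.mul_ne_top
      (ENNReal.natCast_ne_top n) ENNReal.coe_ne_top) ENNReal.ofReal_ne_top) h
    simpa [hDdef, ENNReal.toReal_mul, ENNReal.toReal_ofReal hT] using h'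
  have hA'le : ∀ q, A' q ≤ D := fun q => by
    show (taggedBathAction v T x' q.1 ω₀' q.2.2).toReal ≤ D
    have h := taggedBathAction_le (n := n) hC T x' q.1 ω₀' q.2.2
    have h' := ENNReal.toReal_mono (ENNReal.mul_ne_top (ENNReal.mul_ne_top
      (ENNReal.natCast_ne_top n) ENNReal.coe_ne_top) ENNReal.ofReal_ne_top) h
    simpa [hDdef, ENNReal.toReal_mul, ENNReal.toReal_ofReal hT] using h'
  have hfle : ∀ q, f q ≤ D ^ i * D ^ j := fun q => by
    have hA0 : 0 ≤ A q := ENNReal.toReal_nonneg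
    have hA'0 : 0 ≤ A' q := ENNReal.toReal_nonneg
    have hexp : Real.exp (-(s * A q + t * A' q)) ≤ 1 :=
      Real.exp_le_one_iff.2 (by nlinarith [mul_nonneg hs hA0, mul_nonneg ht hA'0])
    calc f q = A q ^ i * A' q ^ j * Real.exp (-(s * A q + t * A' q)) := rfl
      _ ≤ D ^ i * D ^ j * 1 := by
          gcongr
          · exact hAle q
          · exact hA'le q
      _ = D ^ i * D ^ j := mul_one _
  have hμfin : ∫⁻ q, twoSidedDensity v L T n q
      ∂(volume : Measure (Config n)).prod ((wienerPaths n).prod (wienerPaths n)) ≠ ⊤ := by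
    rw [lintegral_twoSidedDensity hv L T n]
    exact bathTwo_ne_top v L hT n
  haveI : IsFiniteMeasure μ := by
    rw [hμdef, twoSidedMeasure]
    exact isFiniteMeasure_withDensity hμfin
  have hfin : ∫⁻ q, ENNReal.ofReal (f q) ∂μ ≠ ⊤ := by
    refine ne_top_of_le_ne_top ?_ (lintegral_mono fun q => ENNReal.ofReal_le_ofReal (hfle q))
    rw [lintegral_const]
    exact ENNReal.mul_ne_top ENNReal.ofReal_ne_top (measure_ne_top _ _)
  refine ⟨hlin ▸ hfin, ?_⟩
  -- the Bochner integral is the `toReal` of the `[0,∞]` integral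
  show ∫ q, f q ∂μ = _
  rw [integral_eq_lintegral_of_nonneg_ae (Eventually.of_forall hf0) hfm.aestronglyMeasurable, hlin]

end Realisation

namespace Goal

/-- Registered toolbox stub `stub_tiltRealisation`: for bounded measurable `v`, `T ≥ 0`, `s, t ≥ 0`,
the abstract tilted Laplace moments of the realised doses on the two-sided bath space are the line's
two-sided tilted cross moments, which are finite. -/
abbrev stub_tiltRealisation : Prop :=
  ∀ (n : ℕ) {v : ℝ → ℝ≥0∞} {C : ℝ≥0}, Measurable v → (∀ r, v r ≤ C) → ∀ (L : ℝ) {T : ℝ}, 0 ≤ T →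
    ∀ (x : Space) (ω₀ : Fin 3 → (ℝ≥0 → ℝ)) (x' : Space) (ω₀' : Fin 3 → (ℝ≥0 → ℝ)) {s t : ℝ},
      0 ≤ s → 0 ≤ t → ∀ i j : ℕ,
        crossTilt (n := n) s.toNNReal t.toNNReal i j v L T x ω₀ x' ω₀' ≠ ⊤ ∧
        tiltLaplace (twoSidedMeasure v L T n) (doseA v T x ω₀) (doseA' v T x' ω₀') s t i j =
          (crossTilt (n := n) s.toNNReal t.toNNReal i j v L T x ω₀ x' ω₀').toReal

end Goal

/-- PROVED toolbox stub `stub_tiltRealisation` (= `tiltLaplace_eq_crossTilt`). -/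
theorem stub_tiltRealisation : Goal.stub_tiltRealisation :=
  fun _n _v _C hv hC L _T hT x ω₀ x' ω₀' _s _t hs ht i j =>
    tiltLaplace_eq_crossTilt hv hC L hT x ω₀ x' ω₀' hs ht i j

end Summit.AtomisticToContinuum.BoseEinsteinCondensation.Cruxes.TwoReplicaTransienceBound.AcrossCutThinning

end
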